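import Literature.Computability.AlgebraicComplexity.OrderedMonomials
import Literature.Barriers.ValiantsHypothesis.MonotoneGap
import Mathlib.Data.Finset.Max
import HarnessLib

/-!
# Discrepancy implies `ε`-sensitive monotone lower bounds (CDGM 2022, §4)

Chattopadhyay–Datta–Ghosal–Mukhopadhyay, *Monotone complexity of spanning tree polynomial
re-visited* (ITCS 2022, arXiv:2109.06941), §4, **Discrepancy–Sensitivity Correspondence**:
"Consider a distribution `Δ` over `[m]^n`. Then, the monotone complexity of `F_{n,m} - ε·f`
(resp. `F_{n,m} + ε·f`) is at least `ε/(3γ)` (resp. `ε/(6γ)`) as long as `ε ≥ 6γ/(1-3γ)`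
(resp. `ε ≥ 6γ/(1-12γ)`), where `γ := disc_Δ(C^f)`", proved through the measure
`𝓜(κ) = ±Δ(κ)` (sign by membership of `κ` in `f`), Lemma 4.1 (`|𝓜(a·b)| ≤ disc` for nearly
balanced ordered products with `‖a·b‖_∞ ≤ 1`, via the decomposition Lemma 4.3 into rectangles)
and Lemma 4.2 (`|𝓜(F - ε f)| ≥ ε/3`), combined with the structure theorem (Thm. 2.1).

This file proves the correspondence for the spanning tree instance of the tree
(`f = ST_n`, `F_{n-1,n} ∓ ε·ST_n = sensitiveSTPoly N ε sub` of `MonotoneGap.lean`), in an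
unnormalised form that avoids probability: a *signed weight* `w` on maps
`ν : Fin N → Option (Fin N)` (think `w = Z·𝓜`, `Z = Σ|w|`), nonnegative on arborescences and
nonpositive elsewhere, whose rectangle sums `Σ_{τ ∈ S, θ ∈ T} w(τ ∪ θ)` are at most `γ·Z` for
every nearly balanced partition.

* Rectangle bounds dominate bilinear sums (`abs_sum_mul_le_of_abs_sum_le`,
  `abs_sum_sum_mul_le_of_rect`, `abs_sum_sum_mul_le_of_dominated`): the extreme-point argument
  replacing the layer-cake decomposition of Lemma 4.3.
* `measureOf w f = Σ_ν f(κ_ν) w(ν)` (CDGM's `𝓜` extended by linearity), `measureOf_mul` (on an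
  ordered product it is the bilinear form `Σ_{τ,θ} a(κ_τ) b(κ_θ) w(τ ∪ θ)`, by
  `coeff_monoMap_mul`), and **Lemma 4.1** as `abs_measureOf_mul_le`.
* The coefficients of `sensitiveSTPoly` (`stCoeff`, `coeff_monoMap_sensitiveSTPoly`: `1 ∓ ε` on
  arborescences, `1` elsewhere; `≤ 1 + ε`; set-multilinear), and its measure
  `Σ w ∓ ε Σ_{arb} w` (`measureOf_sensitiveSTPoly`, the computation of **Lemma 4.2**).
* **`size_bound_of_discrepancy`**: under the hypotheses above and `6γ ≤ ε(1 - 3γ)`, `ε < 1`,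
  every fan-in-two `ArithCircuit` over `ℝ≥0` computing `F_{n-1,n} ∓ ε·ST_n` satisfies
  `ε/(6γ) ≤ 4 · size · (N+1)²`. Relative to the printed `size ≥ ε/(3γ)` (resp. `ε/(6γ)`): the
  factor `4(N+1)²` is the polynomial number-of-terms factor of the structure theorem in the
  tree (`ArithCircuit.exists_balanced_decomposition`, VSBR form), and one uniform constant `6`
  serves both signs (the coefficient bound `‖p‖_∞ ≤ 1 + ε ≤ 2` is used for both). The
  consumer (`CDGM2022_sensitive`) only needs `2^{Ω(N)}`.

## References

* [ChattopadhyayDattaGhosalMukhopadhyay2022] §4: the measure `𝓜`, Lemmas 4.1, 4.2, 4.3 and the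
  Discrepancy–Sensitivity Correspondence theorem; §2, Thm. 2.1 (used via
  `MonotoneStructure.lean`).
-/

noncomputable section

namespace Literature.Barriers.ValiantsHypothesis

open Literature.Computability.AlgebraicComplexity MvPolynomial Finset
open scoped NNReal

universe u v

/-! ### Rectangle bounds dominate bilinear sums -/

section Rect

variable {X : Type u} {Y : Type v} [Fintype X] [Fintype Y]

/-- If every partial sum of `c` over a set is at most `B` in absolute value, then so is every
`[0,1]`-weighted sum of `c` (the extreme points of the cube are the indicators; CDGM Lemma 4.3
writes the weights as a positive combination of indicators instead).
[cite: ChattopadhyayDattaGhosalMukhopadhyay2022, §4, Lemma 4.3 and proof of Lemma 4.1] -/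
theorem abs_sum_mul_le_of_abs_sum_le (c a : X → ℝ) {B : ℝ}
    (hB : ∀ S : Finset X, |∑ x ∈ S, c x| ≤ B) (ha0 : ∀ x, 0 ≤ a x) (ha1 : ∀ x, a x ≤ 1) :
    |∑ x, a x * c x| ≤ B := by
  classical
  rw [abs_le]
  constructor
  · have h1 : ∑ x ∈ univ.filter (fun x => c x < 0), c x ≤ ∑ x, a x * c x := by
      rw [Finset.sum_filter]
      refine Finset.sum_le_sum fun x _ => ?_
      split_ifs with hx
      · nlinarith [ha0 x, ha1 x]
      · push Not at hx; nlinarith [ha0 x, ha1 x]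
    have h2 := (abs_le.1 (hB (univ.filter fun x => c x < 0))).1
    linarith
  · have h1 : ∑ x, a x * c x ≤ ∑ x ∈ univ.filter (fun x => 0 < c x), c x := by
      rw [Finset.sum_filter]
      refine Finset.sum_le_sum fun x _ => ?_
      split_ifs with hx
      · nlinarith [ha0 x, ha1 x]
      · push Not at hx; nlinarith [ha0 x, ha1 x]
    have h2 := (abs_le.1 (hB (univ.filter fun x => 0 < c x))).2
    linarith

/-- **Rectangle bounds dominate bilinear sums**: if `|Σ_{x ∈ S, y ∈ T} K(x,y)| ≤ γ` for all
rectangles `S × T`, then `|Σ_{x,y} a_x b_y K(x,y)| ≤ γ` for all weights `a, b` with values in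
`[0,1]` (CDGM Lemma 4.1, for rectangle discrepancy).
[cite: ChattopadhyayDattaGhosalMukhopadhyay2022, §4, Lemma 4.1] -/
theorem abs_sum_sum_mul_le_of_rect (K : X → Y → ℝ) {γ : ℝ}
    (hK : ∀ (S : Finset X) (T : Finset Y), |∑ x ∈ S, ∑ y ∈ T, K x y| ≤ γ)
    (a : X → ℝ) (b : Y → ℝ) (ha0 : ∀ x, 0 ≤ a x) (ha1 : ∀ x, a x ≤ 1)
    (hb0 : ∀ y, 0 ≤ b y) (hb1 : ∀ y, b y ≤ 1) :
    |∑ x, ∑ y, a x * b y * K x y| ≤ γ := by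
  have h1 : ∑ x, ∑ y, a x * b y * K x y = ∑ x, a x * ∑ y, b y * K x y := by
    refine sum_congr rfl fun x _ => ?_
    rw [mul_sum]
    refine sum_congr rfl fun y _ => ?_
    ring
  rw [h1]
  refine abs_sum_mul_le_of_abs_sum_le (fun x => ∑ y, b y * K x y) a (fun S => ?_) ha0 ha1
  have h2 : ∑ x ∈ S, ∑ y, b y * K x y = ∑ y, b y * ∑ x ∈ S, K x y := by
    rw [sum_comm]
    exact sum_congr rfl fun y _ => by rw [mul_sum]
  rw [h2]
  refine abs_sum_mul_le_of_abs_sum_le (fun y => ∑ x ∈ S, K x y) b (fun T => ?_) hb0 hb1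
  rw [sum_comm]
  exact hK S T

/-- Scaling form of the previous bound: nonnegative weights `α`, `β` with all products
`α_x β_y ≤ C` give `|Σ_{x,y} α_x β_y K(x,y)| ≤ C·γ` (normalise `α` by its maximum `α₀` and `β`
by `C/α₀`; CDGM: "`Σ λ_{i,j} = ‖a·b‖_∞`"). [cite: ChattopadhyayDattaGhosalMukhopadhyay2022, §4, Lemmas 4.1 and 4.3] -/
theorem abs_sum_sum_mul_le_of_dominated [Nonempty X] (K : X → Y → ℝ) {γ C : ℝ} (hC : 0 ≤ C)
    (hK : ∀ (S : Finset X) (T : Finset Y), |∑ x ∈ S, ∑ y ∈ T, K x y| ≤ γ)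
    (α : X → ℝ) (β : Y → ℝ) (hα0 : ∀ x, 0 ≤ α x) (hβ0 : ∀ y, 0 ≤ β y)
    (hprod : ∀ x y, α x * β y ≤ C) :
    |∑ x, ∑ y, α x * β y * K x y| ≤ C * γ := by
  classical
  have hγ : 0 ≤ γ := by simpa using hK ∅ ∅
  obtain ⟨x₀, -, hx₀⟩ := exists_max_image univ α univ_nonempty
  by_cases hz : α x₀ = 0
  · have hall : ∀ x, α x = 0 := fun x => le_antisymm (hz ▸ hx₀ x (mem_univ x)) (hα0 x)
    rw [Finset.sum_eq_zero (fun x _ => Finset.sum_eq_zero fun y _ => by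
      rw [hall x, zero_mul, zero_mul]), abs_zero]
    exact mul_nonneg hC hγ
  have hpos : 0 < α x₀ := lt_of_le_of_ne (hα0 x₀) (Ne.symm hz)
  by_cases hC0 : C = 0
  · have hβz : ∀ y, β y = 0 := by
      intro y
      have := hprod x₀ y
      rw [hC0] at this
      nlinarith [hβ0 y]
    rw [Finset.sum_eq_zero (fun x _ => Finset.sum_eq_zero fun y _ => by
      rw [hβz y, mul_zero, zero_mul]), abs_zero]
    exact mul_nonneg hC hγ
  have hCpos : 0 < C := lt_of_le_of_ne hC (Ne.symm hC0)
  have key := abs_sum_sum_mul_le_of_rect K hK (fun x => α x / α x₀) (fun y => α x₀ * β y / C)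
    (fun x => div_nonneg (hα0 x) hpos.le)
    (fun x => (div_le_one hpos).2 (hx₀ x (mem_univ x)))
    (fun y => div_nonneg (mul_nonneg hpos.le (hβ0 y)) hC)
    (fun y => (div_le_one hCpos).2 (hprod x₀ y))
  have heq : ∑ x, ∑ y, α x * β y * K x y =
      C * ∑ x, ∑ y, α x / α x₀ * (α x₀ * β y / C) * K x y := by
    rw [mul_sum]
    refine sum_congr rfl fun x _ => ?_
    rw [mul_sum]
    refine sum_congr rfl fun y _ => ?_
    field_simp
  rw [heq, abs_mul, abs_of_nonneg hC]
  exact mul_le_mul_of_nonneg_left key hC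

end Rect

/-! ### The measure of a polynomial (CDGM §4) -/

section Measure

variable {ι : Type u} {κ : Type v} [Fintype ι] [DecidableEq ι] [Fintype κ] [DecidableEq κ]

/-- The (signed) measure of a polynomial in the variables `x_{i,j}` attached to a weight `w` on
maps `ν : ι → κ`: `𝓜(f) = Σ_ν f(κ_ν) · w(ν)`, "defined on the set of monomials" and "extended to
the polynomial by linearity" (only set-multilinear monomials carry weight).
[cite: ChattopadhyayDattaGhosalMukhopadhyay2022, §4 (the measure 𝓜)] -/
def measureOf (w : (ι → κ) → ℝ) (f : MvPolynomial (ι × κ) ℝ≥0) : ℝ :=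
  ∑ ν, ((coeff (monoMap ν) f : ℝ≥0) : ℝ) * w ν

omit [DecidableEq κ] in
/-- The measure is additive. [cite: ChattopadhyayDattaGhosalMukhopadhyay2022, §4 ("by linearity")] -/
theorem measureOf_add (w : (ι → κ) → ℝ) (f g : MvPolynomial (ι × κ) ℝ≥0) :
    measureOf w (f + g) = measureOf w f + measureOf w g := by
  simp only [measureOf, coeff_add, NNReal.coe_add, add_mul, sum_add_distrib]

omit [DecidableEq κ] in
/-- The measure of a list sum. [cite: ChattopadhyayDattaGhosalMukhopadhyay2022, §4 ("sub-additivity")] -/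
theorem measureOf_list_sum (w : (ι → κ) → ℝ) (l : List (MvPolynomial (ι × κ) ℝ≥0)) :
    measureOf w l.sum = (l.map (measureOf w)).sum := by
  induction l with
  | nil => simp [measureOf]
  | cons f l ih => rw [List.sum_cons, measureOf_add, ih, List.map_cons, List.sum_cons]

/-- The measure of an ordered product is a bilinear form in Alice's and Bob's coefficient
vectors: `𝓜(a·b) = Σ_{τ,θ} a(κ_τ) b(κ_θ) w(τ ∪ θ)`. [cite: ChattopadhyayDattaGhosalMukhopadhyay2022, §4, proof of Lemma 4.1] -/
theorem measureOf_mul {A : Finset ι} {a b : MvPolynomial (ι × κ) ℝ≥0} (w : (ι → κ) → ℝ)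
    (ha : IsOrdered A a) (hb : IsOrdered Aᶜ b) :
    measureOf w (a * b) = ∑ τ : {i // i ∈ A} → κ, ∑ θ : {i // i ∈ Aᶜ} → κ,
      ((coeff (monoOf A τ) a : ℝ≥0) : ℝ) * ((coeff (monoOf Aᶜ θ) b : ℝ≥0) : ℝ) *
        w ((splitEquiv A).symm (τ, θ)) := by
  unfold measureOf
  rw [← (splitEquiv (κ := κ) A).symm.sum_comp, Fintype.sum_prod_type]
  refine sum_congr rfl fun τ _ => sum_congr rfl fun θ _ => ?_
  rw [coeff_monoMap_mul ha hb, NNReal.coe_mul,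
    show (fun i : {i // i ∈ A} => (splitEquiv A).symm (τ, θ) i.1) = τ from
      funext fun i => splitEquiv_symm_apply_mem A τ θ i,
    show (fun i : {i // i ∈ Aᶜ} => (splitEquiv A).symm (τ, θ) i.1) = θ from
      funext fun i => splitEquiv_symm_apply_compl A τ θ i]

/-- **Lemma 4.1** (CDGM): for a nearly balanced ordered product `a · b` whose coefficients are at
most `C`, `|𝓜(a·b)| ≤ C · γ` as soon as `γ` bounds the rectangle sums of `w` for the partition
`(I(a), I(b))`. [cite: ChattopadhyayDattaGhosalMukhopadhyay2022, §4, Lemma 4.1] -/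
theorem abs_measureOf_mul_le [Nonempty κ] {A : Finset ι} {a b : MvPolynomial (ι × κ) ℝ≥0}
    (w : (ι → κ) → ℝ) (ha : IsOrdered A a) (hb : IsOrdered Aᶜ b) {C γ : ℝ} (hC : 0 ≤ C)
    (hdom : ∀ ν, ((coeff (monoMap ν) (a * b) : ℝ≥0) : ℝ) ≤ C)
    (hrect : ∀ (S : Finset ({i // i ∈ A} → κ)) (T : Finset ({i // i ∈ Aᶜ} → κ)),
      |∑ τ ∈ S, ∑ θ ∈ T, w ((splitEquiv A).symm (τ, θ))| ≤ γ) :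
    |measureOf w (a * b)| ≤ C * γ := by
  rw [measureOf_mul w ha hb]
  refine abs_sum_sum_mul_le_of_dominated (fun τ θ => w ((splitEquiv A).symm (τ, θ))) hC hrect
    _ _ (fun τ => NNReal.coe_nonneg _) (fun θ => NNReal.coe_nonneg _) fun τ θ => ?_
  have h := hdom ((splitEquiv A).symm (τ, θ))
  rwa [coeff_monoMap_mul ha hb, NNReal.coe_mul,
    show (fun i : {i // i ∈ A} => (splitEquiv A).symm (τ, θ) i.1) = τ from
      funext fun i => splitEquiv_symm_apply_mem A τ θ i,
    show (fun i : {i // i ∈ Aᶜ} => (splitEquiv A).symm (τ, θ) i.1) = θ from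
      funext fun i => splitEquiv_symm_apply_compl A τ θ i] at h

end Measure

/-! ### The perturbed spanning tree polynomial and its measure -/

section ST

variable {N : ℕ}

open Classical in
/-- The coefficient pattern of `F_{n-1,n} ∓ ε·ST_n`: `1 ∓ ε` on arborescences, `1` elsewhere.
[cite: ChattopadhyayDattaGhosalMukhopadhyay2022, §4 ("coefficients exactly 1-ε ... exactly 1")] -/
def stCoeff (ε : ℝ≥0) (sub : Bool) (t : Fin N → Option (Fin N)) : ℝ≥0 :=
  if IsArborescence t then (if sub then 1 - ε else 1 + ε) else 1

/-- The monomial of a map `t` is `Π_i x_{i,t(i)}`. [folklore] -/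
theorem prod_X_eq_monomial_monoMap (t : Fin N → Option (Fin N)) :
    ∏ i, (X (i, t i) : MvPolynomial (Fin N × Option (Fin N)) ℝ≥0) = monomial (monoMap t) 1 := by
  rw [monoMap, monomial_sum_one]
  rfl

/-- `F_{n-1,n} ∓ ε·ST_n = Σ_t c_t · κ_t` with the coefficient pattern `stCoeff`.
[cite: ChattopadhyayDattaGhosalMukhopadhyay2022, §1 (second main theorem) and §4] -/
theorem sensitiveSTPoly_eq (ε : ℝ≥0) (sub : Bool) :
    sensitiveSTPoly N ε sub = ∑ t, stCoeff ε sub t • monomial (monoMap t) 1 := by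
  classical
  unfold sensitiveSTPoly stCoeff
  refine sum_congr rfl fun t _ => ?_
  rw [prod_X_eq_monomial_monoMap]

/-- The coefficients of `F_{n-1,n} ∓ ε·ST_n`. [cite: ChattopadhyayDattaGhosalMukhopadhyay2022, §4] -/
theorem coeff_sensitiveSTPoly (ε : ℝ≥0) (sub : Bool) (m : Fin N × Option (Fin N) →₀ ℕ) :
    coeff m (sensitiveSTPoly N ε sub) = ∑ t, if monoMap t = m then stCoeff ε sub t else 0 := by
  classical
  rw [sensitiveSTPoly_eq, coeff_sum]
  refine sum_congr rfl fun t _ => ?_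
  rw [coeff_smul, coeff_monomial, smul_eq_mul]
  split_ifs <;> simp

/-- The coefficient of `κ_ν` in `F_{n-1,n} ∓ ε·ST_n` is `1 ∓ ε` if `ν` is an arborescence and
`1` otherwise. [cite: ChattopadhyayDattaGhosalMukhopadhyay2022, §4] -/
theorem coeff_monoMap_sensitiveSTPoly (ε : ℝ≥0) (sub : Bool) (ν : Fin N → Option (Fin N)) :
    coeff (monoMap ν) (sensitiveSTPoly N ε sub) = stCoeff ε sub ν := by
  classical
  rw [coeff_sensitiveSTPoly, Finset.sum_eq_single ν]
  · rw [if_pos rfl]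
  · intro t _ ht
    rw [if_neg (fun h => ht (monoMap_injective h))]
  · simp

/-- Coefficients at monomials that are not monomials of maps vanish. [folklore] -/
theorem coeff_sensitiveSTPoly_eq_zero (ε : ℝ≥0) (sub : Bool) {m : Fin N × Option (Fin N) →₀ ℕ}
    (hm : ∀ t, monoMap t ≠ m) : coeff m (sensitiveSTPoly N ε sub) = 0 := by
  rw [coeff_sensitiveSTPoly]
  exact Finset.sum_eq_zero fun t _ => if_neg (hm t)

/-- All coefficients of `F_{n-1,n} ∓ ε·ST_n` are at most `1 + ε`. [cite: ChattopadhyayDattaGhosalMukhopadhyay2022, §4] -/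
theorem coeff_sensitiveSTPoly_le (ε : ℝ≥0) (sub : Bool) (m : Fin N × Option (Fin N) →₀ ℕ) :
    coeff m (sensitiveSTPoly N ε sub) ≤ 1 + ε := by
  by_cases h : ∃ t, monoMap t = m
  · obtain ⟨t, rfl⟩ := h
    rw [coeff_monoMap_sensitiveSTPoly, stCoeff]
    split_ifs
    · exact le_trans tsub_le_self le_self_add
    · exact le_rfl
    · exact le_self_add
  · push Not at h
    rw [coeff_sensitiveSTPoly_eq_zero ε sub h]
    exact zero_le

/-- `F_{n-1,n} ∓ ε·ST_n` is set-multilinear. [cite: ChattopadhyayDattaGhosalMukhopadhyay2022, §4] -/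
theorem isFullyOrdered_sensitiveSTPoly (ε : ℝ≥0) (sub : Bool) :
    IsFullyOrdered (sensitiveSTPoly N ε sub) := by
  intro m hm i
  by_cases h : ∃ t, monoMap t = m
  · obtain ⟨t, rfl⟩ := h
    exact rowDegrees_monoMap t i
  · push Not at h
    exact absurd (coeff_sensitiveSTPoly_eq_zero ε sub h) (mem_support_iff.1 hm)

open Classical in
/-- The measure of `F_{n-1,n} ∓ ε·ST_n`: `𝓜 = Σ_ν w(ν) ∓ ε Σ_{ν arborescence} w(ν)` (CDGM:
"`𝓜(g) = 𝓜(F_{n,m}) - ε·𝓜(f)`"). [cite: ChattopadhyayDattaGhosalMukhopadhyay2022, §4, proof of Lemma 4.2] -/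
theorem measureOf_sensitiveSTPoly (w : (Fin N → Option (Fin N)) → ℝ) {ε : ℝ≥0} (hε : ε ≤ 1)
    (sub : Bool) :
    measureOf w (sensitiveSTPoly N ε sub) =
      ∑ ν, w ν + (if sub then -(ε : ℝ) else ε) *
        ∑ ν ∈ univ.filter (fun ν => IsArborescence ν), w ν := by
  classical
  unfold measureOf
  simp_rw [coeff_monoMap_sensitiveSTPoly]
  rw [Finset.sum_filter, Finset.mul_sum, ← Finset.sum_add_distrib]
  refine sum_congr rfl fun ν _ => ?_
  unfold stCoeff
  split_ifs with h1 h2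
  · rw [NNReal.coe_sub hε]; push_cast; ring
  · push_cast; ring
  · push_cast; ring
  · push_cast; ring

/-- Sums of a list whose terms are bounded in absolute value. [folklore] -/
theorem abs_list_sum_le {l : List ℝ} {B : ℝ} (h : ∀ x ∈ l, |x| ≤ B) :
    |l.sum| ≤ l.length * B := by
  induction l with
  | nil => simp
  | cons x l ih =>
    rw [List.sum_cons, List.length_cons]
    push_cast
    have h1 := h x (by simp)
    have h2 := ih fun y hy => h y (by simp [hy])
    calc |x + l.sum| ≤ |x| + |l.sum| := abs_add_le _ _
      _ ≤ B + l.length * B := add_le_add h1 h2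
      _ = (l.length + 1) * B := by ring

/-- **Discrepancy–Sensitivity Correspondence** (CDGM §4, Thm. + Lemmas 4.1, 4.2, composed with the
structure theorem, Thm. 2.1). Let `w` be a signed weight on maps `ν : Fin N → Option (Fin N)`,
nonnegative on arborescences and nonpositive elsewhere (the measure `𝓜 = ±Δ`), of total mass
`Z = Σ|w| > 0`, whose rectangle sums are at most `γ·Z` for every nearly balanced partition
(`γ = disc_Δ(C^{ST})`). If `6γ ≤ ε(1 - 3γ)` then every fan-in-two circuit over `ℝ≥0` computing
`F_{n-1,n} - ε·ST_n` (`ε < 1`) or `F_{n-1,n} + ε·ST_n` has `4·size·(N+1)² ≥ ε/(6γ)` — the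
printed "monotone complexity at least `ε/(3γ)` (resp. `ε/(6γ)`)", up to the polynomial factor
of the structure theorem used here. [cite: ChattopadhyayDattaGhosalMukhopadhyay2022, §4 (Theorem "Discrepancy-Sensitivity Correspondence", Lemmas 4.1, 4.2)] -/
theorem size_bound_of_discrepancy (hN : 3 ≤ N) (w : (Fin N → Option (Fin N)) → ℝ) {γ : ℝ}
    (hw_arb : ∀ ν, IsArborescence ν → 0 ≤ w ν) (hw_non : ∀ ν, ¬ IsArborescence ν → w ν ≤ 0)
    (hZ : 0 < ∑ ν, |w ν|)
    (hdisc : ∀ A : Finset (Fin N), N < 3 * A.card → 3 * A.card ≤ 2 * N →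
      ∀ (S : Finset ({i // i ∈ A} → Option (Fin N))) (T : Finset ({i // i ∈ Aᶜ} → Option (Fin N))),
        |∑ τ ∈ S, ∑ θ ∈ T, w ((splitEquiv A).symm (τ, θ))| ≤ γ * ∑ ν, |w ν|)
    {ε : ℝ≥0} (hε1 : ε < 1) (hγ0 : 0 < γ) (hεγ : 6 * γ ≤ ε * (1 - 3 * γ)) (sub : Bool)
    (P : ArithCircuit ℝ≥0 (Fin N × Option (Fin N))) (hP : P.IsFanInTwo)
    (hc : P.Computes (sensitiveSTPoly N ε sub)) :
    (ε : ℝ) / (6 * γ) ≤ 4 * P.size * (N + 1) ^ 2 := by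
  classical
  set p := sensitiveSTPoly N ε sub with hp
  set Z := ∑ ν, |w ν| with hZdef
  -- positive and negative mass
  set Warb := ∑ ν ∈ univ.filter (fun ν => IsArborescence ν), w ν with hWarb
  set Wnon := ∑ ν ∈ univ.filter (fun ν => ¬ IsArborescence ν), w ν with hWnon
  have hall : ∑ ν, w ν = Warb + Wnon := (Finset.sum_filter_add_sum_filter_not _ _ _).symm
  have hZeq : Z = Warb - Wnon := by
    rw [hZdef, ← Finset.sum_filter_add_sum_filter_not univ (fun ν => IsArborescence ν),
      hWarb, hWnon, sub_eq_add_neg, ← Finset.sum_neg_distrib]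
    congr 1
    · exact Finset.sum_congr rfl fun ν hν => abs_of_nonneg (hw_arb ν (mem_filter.1 hν).2)
    · exact Finset.sum_congr rfl fun ν hν => abs_of_nonpos (hw_non ν (mem_filter.1 hν).2)
  -- a nearly balanced partition exists, so the total sum is small
  obtain ⟨A₀, -, hA₀⟩ := Finset.exists_subset_card_eq (s := (univ : Finset (Fin N)))
    (n := 2 * N / 3) (by simp; omega)
  have hWall : |∑ ν, w ν| ≤ γ * Z := by
    have h := hdisc A₀ (by omega) (by omega) univ univ
    rwa [← Fintype.sum_prod_type' (f := fun τ θ => w ((splitEquiv A₀).symm (τ, θ))),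
      Equiv.sum_comp (splitEquiv A₀).symm w] at h
  -- lower bound on |𝓜(p)|
  have hmeas : measureOf w p = ∑ ν, w ν + (if sub then -(ε : ℝ) else ε) * Warb :=
    measureOf_sensitiveSTPoly w hε1.le sub
  have hε0 : (0 : ℝ) ≤ ε := NNReal.coe_nonneg ε
  have hγ3 : 3 * γ < 1 := by
    by_contra h
    push Not at h
    have : (ε : ℝ) * (1 - 3 * γ) ≤ 0 := mul_nonpos_of_nonneg_of_nonpos hε0 (by linarith)
    linarith
  have hlow : Z * ε / 3 ≤ |measureOf w p| := by
    have hWarb_ge : Z * (1 - γ) / 2 ≤ Warb := by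
      have := (abs_le.1 hWall).1
      rw [hall] at this
      nlinarith
    rw [hmeas]
    cases sub
    · simp only [Bool.false_eq_true, if_false]
      have h1 := (abs_le.1 hWall).1
      have : Z * ε / 3 ≤ ∑ ν, w ν + ε * Warb := by nlinarith
      exact this.trans (le_abs_self _)
    · simp only [if_true]
      have h1 := (abs_le.1 hWall).2
      have : ∑ ν, w ν + -(ε : ℝ) * Warb ≤ -(Z * ε / 3) := by nlinarith
      calc Z * ε / 3 ≤ -(∑ ν, w ν + -(ε : ℝ) * Warb) := by linarith
        _ ≤ _ := neg_le_abs _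
  -- upper bound from the structure theorem
  obtain ⟨L, hlen, hsum, hL⟩ := ArithCircuit.exists_balanced_decomposition P hP hc
    (isFullyOrdered_sensitiveSTPoly ε sub) (by simpa using hN)
  have hterm : ∀ t ∈ L, |measureOf w (t.2.1 * t.2.2)| ≤ 2 * (γ * Z) := by
    intro t ht
    obtain ⟨ha, hb, hc1, hc2, hdom⟩ := hL t ht
    refine abs_measureOf_mul_le w ha hb (by norm_num) (fun ν => ?_)
      (hdisc t.1 (by simpa using hc1) (by simpa using hc2))
    have h1 : ((coeff (monoMap ν) (t.2.1 * t.2.2) : ℝ≥0) : ℝ) ≤ coeff (monoMap ν) p :=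
      NNReal.coe_le_coe.2 (hdom _)
    have h2 : ((coeff (monoMap ν) p : ℝ≥0) : ℝ) ≤ 1 + ε := by
      have := coeff_sensitiveSTPoly_le ε sub (monoMap ν)
      exact_mod_cast this
    have h3 : (ε : ℝ) ≤ 1 := by exact_mod_cast hε1.le
    linarith
  have hup : |measureOf w p| ≤ (4 * P.size * (N + 1) ^ 2 : ℝ) * (2 * (γ * Z)) := by
    rw [← hsum, measureOf_list_sum, List.map_map]
    refine (abs_list_sum_le (B := 2 * (γ * Z)) fun x hx => ?_).trans ?_
    · obtain ⟨t, ht, rfl⟩ := List.mem_map.1 hx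
      exact hterm t ht
    · rw [List.length_map]
      rw [Fintype.card_fin] at hlen
      have : (L.length : ℝ) ≤ 4 * P.size * (N + 1) ^ 2 := by exact_mod_cast hlen
      have hpos : 0 ≤ 2 * (γ * Z) := by positivity
      exact mul_le_mul_of_nonneg_right this hpos
  -- combine
  have key : Z * ε / 3 ≤ (4 * P.size * (N + 1) ^ 2 : ℝ) * (2 * (γ * Z)) := hlow.trans hup
  rw [div_le_iff₀ (by positivity)]
  nlinarith

end ST

end Literature.Barriers.ValiantsHypothesis
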